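import Literature.Geometry.Lorentzian.TeukolskyRadialFlux
import HarnessLib

/-!
# Conjugation symmetry `(ω, m) ↦ (−ω, −m)` of the normalised scalar radial Teukolsky pair
# (Teixeira da Costa 2020, §2.4.1 / Def. 2.3): WLOG `m > 0`

Companion of `TeukolskyRadialFlux.lean` (R. Teixeira da Costa, Commun. Math. Phys. 378 (2020)
705–781 = arXiv:1910.02854 [Costa2019]). For spin `s = 0` and real `(ω, m, λ)` the homogeneous
radial Teukolsky ODE `Δ R″ + 2(r − M) R′ + (K²/Δ − λ − a²ω² + 2amω) R = 0`,
`K = ω(r² + a²) − am` (`Kerr.IsRadialTeukolskySolution M a 0 ω m λ`), has REAL coefficients which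
are moreover INVARIANT under `(ω, m) ↦ (−ω, −m)` (`K ↦ −K`). Complex conjugation therefore maps
classical solutions with parameters `(ω, m)` to classical solutions with parameters `(−ω, −m)`,
and it maps the normalisations of Def. 2.3 onto each other:

* at `𝓗⁺`: the horizon exponent `ξ(ω, m) = −i (2Mr₊/(r₊ − r₋)) (ω − mω₊)` satisfies
  `ξ(−ω, −m) = −ξ(ω, m) = conj ξ(ω, m)` (`horizonExponent_neg_neg`), and for real `t > 0`,
  `conj (t^z) = t^{conj z}`, so `R(r)(r − r₊)^{−ξ} = f(r)` smooth at `r₊` with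
  `|f(r₊)| (r₊² + a²)^{1/2} = 1` gives the same for `(conj R, conj f, −ω, −m)`
  (`isNormalisedHorizonSolution_conj_neg`);
* at `𝓘⁺`: `conj (e^{iωr + 2iMω log r} Σ c_k r^{−k−1}) = e^{−iωr − 2iMω log r} Σ conj(c_k) r^{−k−1}`,
  `|conj c₀| = 1` (`isNormalisedInfinitySolution_conj_neg`);
* the Wronskian `𝔚 = Δ (R_𝓗 R_𝓘′ − R_𝓘 R_𝓗′)` of the conjugated pair is `conj 𝔚`
  (`radialWronskian_conj`), and DRSR's admissibility `Λ ≥ |m|(|m|+1)`, `Λ ≥ 2|amω|` is invariant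
  (`isAdmissibleTriple_neg_neg_iff`).

Consequence (`coneKernelBound_of_pos`): a bound on the diagonal-type kernel product
`(r² + a²)^{1/2}|R_𝓗(r)| · (r′² + a²)^{1/2}|R_𝓘(r′)| ≤ C |m|^N κ₊^{−N} |𝔚|` for the normalised pair in
a cone `|ω − mω₊| ≤ ε₀|m|` around the superradiant threshold, under any frequency-regime
hypothesis `P` invariant under `(ω, m) ↦ (−ω, −m)`, need only be proved for `m > 0`: the case
`m < 0` follows by conjugation; `coneKernelBound_of_pos_poly` is its twin for bounds with the
Λ-polynomial constant `C Λ^N κ₊^{−N}` (`Λ` is invariant too). Everything is proved; theorems only.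

## References
* R. Teixeira da Costa, CMP 378 (2020) 705–781 = arXiv:1910.02854: §2.2.1 (`ξ`), §2.2.3 (radial
  ODE), Def. 2.3 (normalised solutions), §2.4.1 (real coefficients, `T`-current), Def. 5.1.
  [Costa2019]
* M. Dafermos, I. Rodnianski, Y. Shlapentokh-Rothman, arXiv:1402.7034: §4.2 (the discrete
  symmetries `(ω, m) ↦ (−ω, −m)`, `a ↦ −a`), Def. 6.1.1. [DafermosRodnianskiShlapentokhrothman2014]
-/

noncomputable section

open Complex Set
open scoped ComplexConjugate

namespace Literature.Geometry.Lorentzian.Kerr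

namespace Costa2019

/-! ### The radial ODE and the frequency data under `(ω, m) ↦ (−ω, −m)` -/

/-- **The scalar radial Teukolsky ODE is invariant under `(ω, m) ↦ (−ω, −m)`** (`s = 0`, real
parameters): `K(−ω, −m) = −K(ω, m)` enters only through `K²`, and `a²ω²`, `2amω` are even.
[cite: Costa2019, §2.4.1] -/
theorem isRadialTeukolskySolution_neg_neg_iff {M a ω m lam : ℝ} {R : ℝ → ℂ} :
    IsRadialTeukolskySolution M a 0 (-ω) (-m) lam R ↔ IsRadialTeukolskySolution M a 0 ω m lam R := by
  have h1 : ∀ r : ℝ, radialK a (-ω) (-m) r ^ 2 = radialK a ω m r ^ 2 := fun r => by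
    unfold radialK; ring
  have h2 : a ^ 2 * (-ω) ^ 2 = a ^ 2 * ω ^ 2 := by ring
  have h3 : 2 * a * -m * -ω = 2 * a * m * ω := by ring
  simp only [IsRadialTeukolskySolution, h1, h2, h3, Complex.ofReal_zero, mul_zero, zero_mul,
    sub_zero, add_zero]

/-- **The horizon exponent under `(ω, m) ↦ (−ω, −m)`**: `ξ(−ω, −m) = conj ξ(ω, m)` (both equal
`−ξ(ω, m)`, `ξ = −i (2Mr₊/(r₊ − r₋))(ω − mω₊)` being purely imaginary). [cite: Costa2019, §2.2.1] -/
theorem horizonExponent_neg_neg (M a ω m : ℝ) :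
    horizonExponent M a (-ω) (-m) = conj (horizonExponent M a ω m) := by
  unfold horizonExponent
  rw [map_mul, map_neg, Complex.conj_I, Complex.conj_ofReal]
  push_cast
  ring

/-- **Admissibility is invariant under `(ω, m) ↦ (−ω, −m)`** (DRSR Def. 6.1.1:
`|m|(|m| + 1) ≤ Λ`, `2|amω| ≤ Λ`). [folklore] -/
theorem isAdmissibleTriple_neg_neg_iff {a ω : ℝ} {m : ℤ} {Λ : ℝ} :
    IsAdmissibleTriple a (-ω) (-m) Λ ↔ IsAdmissibleTriple a ω m Λ := by
  simp only [IsAdmissibleTriple, Int.cast_neg, abs_neg, mul_neg, neg_mul, neg_neg]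

/-! ### Conjugation of the normalised solutions -/

/-- `t^{conj z} = conj (t^z)` for real `t ≥ 0` (the argument of `t` is `0 ≠ π`). [folklore] -/
private theorem ofReal_cpow_conj_eq {t : ℝ} (ht : 0 ≤ t) (z : ℂ) :
    ((t : ℝ) : ℂ) ^ conj z = conj (((t : ℝ) : ℂ) ^ z) := by
  rw [Complex.cpow_conj _ _ (by rw [Complex.arg_ofReal_of_nonneg ht]; exact Real.pi_ne_zero.symm),
    Complex.conj_ofReal]

/-- **Conjugation maps `R_{𝓗⁺}(ω, m)` to `R_{𝓗⁺}(−ω, −m)`** (Def. 2.3, `s = 0`, `|a| < M`): if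
`R(r)(r − r₊)^{−ξ} = f(r)` on a collar with `f` smooth at `r₊` and
`|f(r₊)|·(r₊² + a²)^{1/2} = 1`, then `conj R (r)(r − r₊)^{−conj ξ} = conj f (r)` with `conj f`
smooth and of the same modulus, and `conj ξ(ω, m) = ξ(−ω, −m)`. [cite: Costa2019, Definition 2.3] -/
theorem isNormalisedHorizonSolution_conj_neg {M a ω m : ℝ} {R : ℝ → ℂ}
    (h : IsNormalisedHorizonSolution M a 0 ω m R) :
    IsNormalisedHorizonSolution M a 0 (-ω) (-m) (fun r ↦ conj (R r)) := by
  obtain ⟨ε, hε, f, hf, hRf, hnorm⟩ := h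
  refine ⟨ε, hε, fun r => conj (f r), Complex.conjCLE.contDiff.comp_contDiffOn hf,
    fun r hr => ?_, by rw [Complex.norm_conj]; exact hnorm⟩
  dsimp only
  rw [horizonExponent_neg_neg, ← hRf r hr, map_mul]
  congr 1
  rw [← ofReal_cpow_conj_eq (sub_pos.2 hr.1).le, map_sub, Complex.conj_ofReal]

/-- The oscillatory factor of the outgoing expansion under conjugation:
`conj (e^{iωr + 2iMω log r}) = e^{i(−ω)r + 2iM(−ω) log r}` (real `M`, `ω`, `r`). [folklore] -/
private theorem conj_exp_phase (M ω r : ℝ) :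
    conj (exp (I * ω * r + 2 * I * M * ω * Real.log r)) =
      exp (I * (-ω : ℝ) * r + 2 * I * M * (-ω : ℝ) * Real.log r) := by
  rw [← Complex.exp_conj]
  congr 1
  simp only [map_add, map_mul, Complex.conj_I, Complex.conj_ofReal, map_ofNat]
  push_cast
  ring

/-- **Conjugation maps `R_{𝓘⁺}(ω)` to `R_{𝓘⁺}(−ω)`** (Def. 2.3, `s = 0`): if
`R = e^{iωr + 2iMω log r} Σ_{k ≤ N} c_k r^{−k−1} + O(r^{−N−2})` for every `N ≥ 1` with `|c₀| = 1`,
then `conj R = e^{−iωr − 2iMω log r} Σ_{k ≤ N} conj(c_k) r^{−k−1} + O(r^{−N−2})` with the same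
constants and `|conj c₀| = 1`. [cite: Costa2019, Definition 2.3] -/
theorem isNormalisedInfinitySolution_conj_neg {M ω : ℝ} {R : ℝ → ℂ}
    (h : IsNormalisedInfinitySolution M 0 ω R) :
    IsNormalisedInfinitySolution M 0 (-ω) (fun r ↦ conj (R r)) := by
  obtain ⟨c, hc0, hc⟩ := h
  refine ⟨fun k => conj (c k), by rw [Complex.norm_conj, hc0], fun N hN => ?_⟩
  obtain ⟨C, r₀, hC⟩ := hc N hN
  refine ⟨C, r₀, fun r hr => le_of_eq_of_le ?_ (hC r hr)⟩
  rw [← Complex.norm_conj (R r - _), map_sub, map_mul, conj_exp_phase, map_sum]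
  simp only [map_mul, Complex.conj_ofReal]

/-- **The Wronskian of the conjugated pair** (any `s`, pointwise, both functions differentiable at
`r`): `𝔚(conj R_𝓗, conj R_𝓘)(r) = conj (𝔚(R_𝓗, R_𝓘)(r))` (`Δ^{1+s}` is real). [folklore] -/
theorem radialWronskian_conj {M a s : ℝ} {RH RI : ℝ → ℂ} {r : ℝ}
    (hH : DifferentiableAt ℝ RH r) (hI : DifferentiableAt ℝ RI r) :
    radialWronskian M a s (fun y ↦ conj (RH y)) (fun y ↦ conj (RI y)) r =
      conj (radialWronskian M a s RH RI r) := by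
  simp only [radialWronskian_apply, deriv_conj_eq hH.hasDerivAt, deriv_conj_eq hI.hasDerivAt,
    map_mul, map_sub, Complex.conj_ofReal]

/-! ### WLOG `m > 0` for cone kernel bounds -/

/-- **WLOG `0 < m`** for cone kernel bounds of the normalised scalar pair whose frequency-regime
hypothesis `P` is invariant under `(ω, m) ↦ (−ω, −m)`: if for every `M > 0`, `θ > 0` there are
`a₁ < M`, `ε₀ > 0`, `C > 0`, `N` such that for all `a₁ ≤ |a| < M`, all admissible `(ω, m, Λ)` with
`m > 0` in the cone `|ω − mω₊| ≤ ε₀|m|` satisfying `P`, and all classical solutions `R_𝓗`, `R_𝓘`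
of the scalar radial ODE (`λ = Λ − a²ω²`) normalised at `𝓗⁺` resp. `𝓘⁺`,
`(r² + a²)^{1/2}|R_𝓗(r)|·(r′² + a²)^{1/2}|R_𝓘(r′)| ≤ C|m|^N κ₊^{−N} |𝔚(r)|` for
`r₊ < r ≤ r′`, `r′ ≥ r₊ + θ(r₊ − r₋)`, then the same holds for all `m ≠ 0` (same constants): for
`m < 0` apply the hypothesis to `(−ω, −m, conj R_𝓗, conj R_𝓘)` — the ODE, the normalisations, the
cone, admissibility and `|𝔚|` are all invariant. [cite: Costa2019, §2.4.1] -/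
theorem coneKernelBound_of_pos (P : ℝ → ℝ → ℝ → ℤ → Prop)
    (hP : ∀ M a ω m, P M a ω m → P M a (-ω) (-m))
    (h : ∀ M : ℝ, 0 < M → ∀ θ : ℝ, 0 < θ → ∃ (a₁ ε₀ C : ℝ) (N : ℕ), a₁ < M ∧ 0 < ε₀ ∧ 0 < C ∧
      ∀ a : ℝ, a₁ ≤ |a| → Kerr.IsSubextremal M a →
        ∀ (ω : ℝ) (m : ℤ) (Λ : ℝ), Kerr.IsAdmissibleTriple a ω m Λ → 0 < m →
          |ω - m * Kerr.horizonAngularVelocity M a| ≤ ε₀ * |(m : ℝ)| → P M a ω m →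
            ∀ RH RI : ℝ → ℂ,
              Kerr.IsRadialTeukolskySolution M a 0 ω m (Λ - a ^ 2 * ω ^ 2) RH →
              Kerr.IsNormalisedHorizonSolution M a 0 ω m RH →
              Kerr.IsRadialTeukolskySolution M a 0 ω m (Λ - a ^ 2 * ω ^ 2) RI →
              Kerr.IsNormalisedInfinitySolution M 0 ω RI →
                ∀ r r' : ℝ, Kerr.rPlus M a < r → r ≤ r' →
                  Kerr.rPlus M a + θ * (Kerr.rPlus M a - Kerr.rMinus M a) ≤ r' →
                    Real.sqrt (r ^ 2 + a ^ 2) * ‖RH r‖ * (Real.sqrt (r' ^ 2 + a ^ 2) * ‖RI r'‖) ≤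
                      C * |(m : ℝ)| ^ N * (Kerr.surfaceGravity M a)⁻¹ ^ N *
                        ‖Kerr.radialWronskian M a 0 RH RI r‖) :
    ∀ M : ℝ, 0 < M → ∀ θ : ℝ, 0 < θ → ∃ (a₁ ε₀ C : ℝ) (N : ℕ), a₁ < M ∧ 0 < ε₀ ∧ 0 < C ∧
      ∀ a : ℝ, a₁ ≤ |a| → Kerr.IsSubextremal M a →
        ∀ (ω : ℝ) (m : ℤ) (Λ : ℝ), Kerr.IsAdmissibleTriple a ω m Λ → m ≠ 0 →
          |ω - m * Kerr.horizonAngularVelocity M a| ≤ ε₀ * |(m : ℝ)| → P M a ω m →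
            ∀ RH RI : ℝ → ℂ,
              Kerr.IsRadialTeukolskySolution M a 0 ω m (Λ - a ^ 2 * ω ^ 2) RH →
              Kerr.IsNormalisedHorizonSolution M a 0 ω m RH →
              Kerr.IsRadialTeukolskySolution M a 0 ω m (Λ - a ^ 2 * ω ^ 2) RI →
              Kerr.IsNormalisedInfinitySolution M 0 ω RI →
                ∀ r r' : ℝ, Kerr.rPlus M a < r → r ≤ r' →
                  Kerr.rPlus M a + θ * (Kerr.rPlus M a - Kerr.rMinus M a) ≤ r' →
                    Real.sqrt (r ^ 2 + a ^ 2) * ‖RH r‖ * (Real.sqrt (r' ^ 2 + a ^ 2) * ‖RI r'‖) ≤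
                      C * |(m : ℝ)| ^ N * (Kerr.surfaceGravity M a)⁻¹ ^ N *
                        ‖Kerr.radialWronskian M a 0 RH RI r‖ := by
  intro M hM θ hθ
  obtain ⟨a₁, ε₀, C, N, ha₁, hε₀, hC, hmain⟩ := h M hM θ hθ
  refine ⟨a₁, ε₀, C, N, ha₁, hε₀, hC, ?_⟩
  intro a ha hsub ω m Λ hadm hm hcone hPm RH RI hRH hnH hRI hnI r r' hr hrr' hr'
  rcases lt_or_gt_of_ne hm with hneg | hpos
  · -- `m < 0`: conjugate and flip the signs of `(ω, m)`
    have hm' : (0 : ℤ) < -m := neg_pos.2 hneg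
    have hadm' : IsAdmissibleTriple a (-ω) (-m) Λ := isAdmissibleTriple_neg_neg_iff.2 hadm
    have hcone' : |-ω - ((-m : ℤ) : ℝ) * horizonAngularVelocity M a| ≤ ε₀ * |((-m : ℤ) : ℝ)| := by
      have e : -ω - ((-m : ℤ) : ℝ) * horizonAngularVelocity M a =
          -(ω - m * horizonAngularVelocity M a) := by
        push_cast; ring
      rw [e, abs_neg, Int.cast_neg, abs_neg]
      exact hcone
    have hRH' : IsRadialTeukolskySolution M a 0 (-ω) ((-m : ℤ) : ℝ) (Λ - a ^ 2 * (-ω) ^ 2)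
        (fun y => conj (RH y)) := by
      rw [Int.cast_neg, isRadialTeukolskySolution_neg_neg_iff, neg_sq]
      exact isRadialTeukolskySolution_conj hRH
    have hnH' : IsNormalisedHorizonSolution M a 0 (-ω) ((-m : ℤ) : ℝ) (fun y => conj (RH y)) := by
      rw [Int.cast_neg]
      exact isNormalisedHorizonSolution_conj_neg hnH
    have hRI' : IsRadialTeukolskySolution M a 0 (-ω) ((-m : ℤ) : ℝ) (Λ - a ^ 2 * (-ω) ^ 2)
        (fun y => conj (RI y)) := by
      rw [Int.cast_neg, isRadialTeukolskySolution_neg_neg_iff, neg_sq]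
      exact isRadialTeukolskySolution_conj hRI
    have hnI' : IsNormalisedInfinitySolution M 0 (-ω) (fun y => conj (RI y)) :=
      isNormalisedInfinitySolution_conj_neg hnI
    have key := hmain a ha hsub (-ω) (-m) Λ hadm' hm' hcone' (hP M a ω m hPm) _ _ hRH' hnH' hRI'
      hnI' r r' hr hrr' hr'
    obtain ⟨RH₁, RH₂, hdH⟩ := hRH
    obtain ⟨RI₁, RI₂, hdI⟩ := hRI
    rw [radialWronskian_conj (hdH r hr).1.differentiableAt (hdI r hr).1.differentiableAt] at key
    simpa only [Complex.norm_conj, Int.cast_neg, abs_neg] using key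
  · exact hmain a ha hsub ω m Λ hadm hpos hcone hPm RH RI hRH hnH hRI hnI r r' hr hrr' hr'

/-- **WLOG `0 < m`, Λ-polynomial constant** — the twin of `coneKernelBound_of_pos` for cone
kernel bounds with the constant `C Λ^N κ₊^{−N}` (a power of the angular eigenvalue `Λ` instead of
`|m|^N`; needed once the bound is only polynomial in `Λ`, e.g. Airy growth at a turning point):
if the bound `(r² + a²)^{1/2}|R_𝓗(r)|·(r′² + a²)^{1/2}|R_𝓘(r′)| ≤ C Λ^N κ₊^{−N} |𝔚(r)|` holds for
the normalised pair for all admissible `(ω, m, Λ)` with `m > 0` in the cone under a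
frequency-regime hypothesis `P` invariant under `(ω, m) ↦ (−ω, −m)`, then it holds for all `m ≠ 0`
(same constants): for `m < 0` apply it to `(−ω, −m, Λ, conj R_𝓗, conj R_𝓘)` — the ODE, the
normalisations, the cone, admissibility, `Λ` and `|𝔚|` are all invariant. [cite: Costa2019, §2.4.1] -/
theorem coneKernelBound_of_pos_poly (P : ℝ → ℝ → ℝ → ℤ → Prop)
    (hP : ∀ M a ω m, P M a ω m → P M a (-ω) (-m))
    (h : ∀ M : ℝ, 0 < M → ∀ θ : ℝ, 0 < θ → ∃ (a₁ ε₀ C : ℝ) (N : ℕ), a₁ < M ∧ 0 < ε₀ ∧ 0 < C ∧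
      ∀ a : ℝ, a₁ ≤ |a| → Kerr.IsSubextremal M a →
        ∀ (ω : ℝ) (m : ℤ) (Λ : ℝ), Kerr.IsAdmissibleTriple a ω m Λ → 0 < m →
          |ω - m * Kerr.horizonAngularVelocity M a| ≤ ε₀ * |(m : ℝ)| → P M a ω m →
            ∀ RH RI : ℝ → ℂ,
              Kerr.IsRadialTeukolskySolution M a 0 ω m (Λ - a ^ 2 * ω ^ 2) RH →
              Kerr.IsNormalisedHorizonSolution M a 0 ω m RH →
              Kerr.IsRadialTeukolskySolution M a 0 ω m (Λ - a ^ 2 * ω ^ 2) RI →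
              Kerr.IsNormalisedInfinitySolution M 0 ω RI →
                ∀ r r' : ℝ, Kerr.rPlus M a < r → r ≤ r' →
                  Kerr.rPlus M a + θ * (Kerr.rPlus M a - Kerr.rMinus M a) ≤ r' →
                    Real.sqrt (r ^ 2 + a ^ 2) * ‖RH r‖ * (Real.sqrt (r' ^ 2 + a ^ 2) * ‖RI r'‖) ≤
                      C * Λ ^ N * (Kerr.surfaceGravity M a)⁻¹ ^ N *
                        ‖Kerr.radialWronskian M a 0 RH RI r‖) :
    ∀ M : ℝ, 0 < M → ∀ θ : ℝ, 0 < θ → ∃ (a₁ ε₀ C : ℝ) (N : ℕ), a₁ < M ∧ 0 < ε₀ ∧ 0 < C ∧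
      ∀ a : ℝ, a₁ ≤ |a| → Kerr.IsSubextremal M a →
        ∀ (ω : ℝ) (m : ℤ) (Λ : ℝ), Kerr.IsAdmissibleTriple a ω m Λ → m ≠ 0 →
          |ω - m * Kerr.horizonAngularVelocity M a| ≤ ε₀ * |(m : ℝ)| → P M a ω m →
            ∀ RH RI : ℝ → ℂ,
              Kerr.IsRadialTeukolskySolution M a 0 ω m (Λ - a ^ 2 * ω ^ 2) RH →
              Kerr.IsNormalisedHorizonSolution M a 0 ω m RH →
              Kerr.IsRadialTeukolskySolution M a 0 ω m (Λ - a ^ 2 * ω ^ 2) RI →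
              Kerr.IsNormalisedInfinitySolution M 0 ω RI →
                ∀ r r' : ℝ, Kerr.rPlus M a < r → r ≤ r' →
                  Kerr.rPlus M a + θ * (Kerr.rPlus M a - Kerr.rMinus M a) ≤ r' →
                    Real.sqrt (r ^ 2 + a ^ 2) * ‖RH r‖ * (Real.sqrt (r' ^ 2 + a ^ 2) * ‖RI r'‖) ≤
                      C * Λ ^ N * (Kerr.surfaceGravity M a)⁻¹ ^ N *
                        ‖Kerr.radialWronskian M a 0 RH RI r‖ := by
  intro M hM θ hθ
  obtain ⟨a₁, ε₀, C, N, ha₁, hε₀, hC, hmain⟩ := h M hM θ hθ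
  refine ⟨a₁, ε₀, C, N, ha₁, hε₀, hC, ?_⟩
  intro a ha hsub ω m Λ hadm hm hcone hPm RH RI hRH hnH hRI hnI r r' hr hrr' hr'
  rcases lt_or_gt_of_ne hm with hneg | hpos
  · -- `m < 0`: conjugate and flip the signs of `(ω, m)`; `Λ` is unchanged
    have hm' : (0 : ℤ) < -m := neg_pos.2 hneg
    have hadm' : IsAdmissibleTriple a (-ω) (-m) Λ := isAdmissibleTriple_neg_neg_iff.2 hadm
    have hcone' : |-ω - ((-m : ℤ) : ℝ) * horizonAngularVelocity M a| ≤ ε₀ * |((-m : ℤ) : ℝ)| := by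
      have e : -ω - ((-m : ℤ) : ℝ) * horizonAngularVelocity M a =
          -(ω - m * horizonAngularVelocity M a) := by
        push_cast; ring
      rw [e, abs_neg, Int.cast_neg, abs_neg]
      exact hcone
    have hRH' : IsRadialTeukolskySolution M a 0 (-ω) ((-m : ℤ) : ℝ) (Λ - a ^ 2 * (-ω) ^ 2)
        (fun y => conj (RH y)) := by
      rw [Int.cast_neg, isRadialTeukolskySolution_neg_neg_iff, neg_sq]
      exact isRadialTeukolskySolution_conj hRH
    have hnH' : IsNormalisedHorizonSolution M a 0 (-ω) ((-m : ℤ) : ℝ) (fun y => conj (RH y)) := by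
      rw [Int.cast_neg]
      exact isNormalisedHorizonSolution_conj_neg hnH
    have hRI' : IsRadialTeukolskySolution M a 0 (-ω) ((-m : ℤ) : ℝ) (Λ - a ^ 2 * (-ω) ^ 2)
        (fun y => conj (RI y)) := by
      rw [Int.cast_neg, isRadialTeukolskySolution_neg_neg_iff, neg_sq]
      exact isRadialTeukolskySolution_conj hRI
    have hnI' : IsNormalisedInfinitySolution M 0 (-ω) (fun y => conj (RI y)) :=
      isNormalisedInfinitySolution_conj_neg hnI
    have key := hmain a ha hsub (-ω) (-m) Λ hadm' hm' hcone' (hP M a ω m hPm) _ _ hRH' hnH' hRI'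
      hnI' r r' hr hrr' hr'
    obtain ⟨RH₁, RH₂, hdH⟩ := hRH
    obtain ⟨RI₁, RI₂, hdI⟩ := hRI
    rw [radialWronskian_conj (hdH r hr).1.differentiableAt (hdI r hr).1.differentiableAt] at key
    simpa only [Complex.norm_conj] using key
  · exact hmain a ha hsub ω m Λ hadm hpos hcone hPm RH RI hRH hnH hRI hnI r r' hr hrr' hr'

end Costa2019

end Literature.Geometry.Lorentzian.Kerr

end
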